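import Literature.AlgebraicGeometry.Modules.GrothendieckComplexOfProper
import Literature.Algebra.Homology.BaseChangeComplex
import Literature.Algebra.Homology.VanishingBaseChangeOfQuasiIso
import Literature.Algebra.Homology.QuasiIsoLocal
import Mathlib.RingTheory.LocalRing.ResidueField.Ideal
import HarnessLib

/-!
# Fibrewise exact at every maximal ideal ⇒ exact after EVERY base change: cohomology and base change above the vanishing
# line, GLOBALISED over a noetherian base (Mumford AV §5 Cor. 3 with Lemmas 1–2; EGA III 7.7.5 ∕ 7.7.10; Hartshorne III 12.11)

Topic `AlgebraicGeometry/Modules`; namespace `Literature.AlgebraicGeometry.Modules`.  THEOREMS ONLY (no definition,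
no named fact, no instance, no notation, no `sorry`; books 0); the carrier `A ⊗_R P•` with canonical instances is ★
`Algebra/Homology/BaseChangeComplex` (`baseChangeComplex`).

Cell hodgecm-mathlib (D-0151), P6 «MOD programme», DUAL-S road (A) in characteristic `p`, **brick (CBC-1) of B-p08 (g33)'s
«CBC CUT» memo v1 (2026-09-01T23:59Z)** — the «fibrewise-exact ⇒ exact after every base change» input of (CBC-4) «PIC0-ONTO, any
characteristic» ([MumfordAV1970] §8 Thm. 1, Steps 1–2 of the memo) — B-p04 (g40), lineage ★ (h2) `ModuleCechFiniteOfProper` ∕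
`GrothendieckComplexOfProper` ∕ `VanishingBaseChangeOfQuasiIso` (B-p04 g18∕g19).  HC_CM is proved only modulo the printed
citations (2 remaining named inputs hLiu418 24832, h413 24833) until rung 0 closes; this file is count-neutral capital.

THE MATHEMATICS ([MumfordAV1970] §5 Cor. 3 «if `Hⁱ(X_y, F_y) = 0` for all `y ∈ Y` and all `i ≥ q` then …» — its proof is LOCAL on
`Y = Spec R`: Lemma 1 gives the Grothendieck complex `P• ⥲ C•` (strictly perfect, `C•` the flat Čech complex), Lemma 2 moves base
change across the quasi-isomorphism, and over the LOCAL rings `R_𝔪` Nakayama makes `P•_𝔪` split exact above the vanishing line,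
★ `StrictlyPerfectVanishingBaseChange` ∕ ★ `VanishingBaseChangeOfQuasiIso` §3).  The tree holds the local statement over a LOCAL ring
`R`; this file removes «local»: a property of `R`-modules that holds after `⊗ R_𝔪` for every maximal `𝔪` holds ([AtiyahMacdonald1969]
Props. 3.8–3.9; Mathlib `exact_of_isLocalized_maximal`), and `R_𝔪 ⊗_R (B ⊗_R P•) = (R_𝔪 ⊗_R B) ⊗_{R_𝔪} (R_𝔪 ⊗_R P•)` puts us over
the local ring `R_𝔪` with test algebra `R_𝔪 ⊗_R B` and residue field `κ(𝔪)` (Mathlib `Ideal.ResidueField`):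

* §1 = ★ `Algebra/Homology/BaseChangeComplex` (`baseChangeComplex A P•`: `X n := A ⊗_R Pⁿ`, `d := d ⊗ A`, canonical instances —
  Mathlib's `ModuleCat.extendScalars` carries the `RestrictScalars` module structure on `A`, not definitionally the algebra's when `A = R_𝔪`).
* §2 LADDERS for `Function.Exact` of base-changed pairs: `function_exact_baseChange_baseChange_iff` (`(d ⊗ A) ⊗_A T` vs `d ⊗ T` along
  an `IsScalarTower R A T`, Mathlib `cancelBaseChange`), `function_exact_baseChange_baseChange_iff_tensor` (`(d ⊗ B) ⊗_R A` vs
  `d ⊗ (A ⊗_R B)`, Mathlib `TensorProduct.assoc`), `function_exact_baseChange_self_iff` (`d ⊗ R` vs `d`, Mathlib `TensorProduct.lid`).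
* §3 **`exact_baseChange_of_exact_residueField_algebra`** — the ★ LOCAL theorem over any local `R`-ALGEBRA `R'` read on `R`-linear data
  (`P•` strictly perfect over `R`, fibre hypothesis at `κ(R')`, conclusion for every `R'`-algebra `T` in the tower);
  **`exact_baseChange_of_forall_isMaximal_exact_residueField`** — GLOBAL: `P•` strictly perfect over ANY commutative `R`, exact at `κ(𝔪)`
  in degrees `≥ q` for every maximal `𝔪` ⇒ `P• ⊗ B` exact in degrees `≥ q` for EVERY `R`-algebra `B`;
  **`exact_baseChange_of_quasiIso_of_forall_isMaximal_exact_residueField`** — the same ON THE FLAT COMPLEX `C•` through a strictly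
  perfect witness `ψ : P• ⥲ C•` (★ `function_exact_baseChange_iff_of_quasiIso`, Mumford §5 Lemma 2); `…_self` corollaries (`B := R`:
  `C•` itself is exact in degrees `≥ q`, `ExactAt` ∕ `Function.Exact` forms).
* §4 **THE ČECH FORM (CBC-1 (E1))**: `g : X → B` proper flat, `B` affine locally noetherian, `G` finite locally free, `𝓤` a finite cover
  with affine finite intersections, `C• := Modules.cechComplex 𝓤 G g♯` (the setting and dialect of ★ `GrothendieckComplexOfProper` §1):
  **`cechComplex_exact_baseChange_of_forall_isMaximal`** — exact at `κ(𝔪)` in degrees `≥ q` for every maximal `𝔪 ⊂ Γ(B, 𝒪_B)` ⇒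
  exact after every base change `Γ(B) → B'` in degrees `≥ q`; **`cechComplex_exactAt_of_forall_isMaximal`** — in particular
  `Hⁱ(Č•(𝓤, G)) = 0` for `i ≥ q` (★ Grothendieck complex `exists_strictlyPerfect_quasiIso_cechComplex_of_isProper`, ★ `flat_cechComplex_X`).
The geometric readings at `k`-POINTS of a finite-type base over `k = k̄` ((E1′)∕(E1″) of the memo: fibre Čech complexes via ★
`exists_extendScalars_cechComplex_iso_of_isPullback`, maximal ideals = `k`-points by the Nullstellensatz, `κ(𝔪) ≃ k` along ★
`function_exact_baseChange_iff_of_linearEquiv`) are the sequel file `CechComplexExactOfFibrewiseExactPoints`.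

## References
* [MumfordAV1970] D. Mumford, *Abelian Varieties* (1970), §5: Lemma 1 (p. 47), Lemma 2 (p. 49), Cor. 2 (p. 50), Cor. 3 (p. 53).
* [Hartshorne1977] R. Hartshorne, *Algebraic Geometry* (1977), III Thm. 12.11 (p. 290) (cohomology and base change).
* [EGAIII2] A. Grothendieck, J. Dieudonné, EGA III₂ (Publ. Math. IHÉS 17, 1963), 7.7.5, 7.7.10.
* [AtiyahMacdonald1969] M. F. Atiyah, I. G. Macdonald, *Introduction to Commutative Algebra* (1969), Ch. 3 Props. 3.3, 3.5, 3.8, 3.9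
  (localisation is exact; local properties).
* [GortzWedhorn2023] U. Görtz, T. Wedhorn, *Algebraic Geometry II* (2023), Thm. 23.133 ∕ Cor. 23.135 (pp. 354–355) (Grothendieck
  complex), Thm. 23.140 (cohomology and base change).
* Tree: ★ `GrothendieckComplexOfProper` (`exists_strictlyPerfect_quasiIso_cechComplex_of_isProper`, `flat_secMod_of_flat`), ★
  `ModuleCechComplex` (`cechComplex`, `flat_cechComplex_X`, `isStrictlyLE_cechComplex`), ★ `VanishingBaseChangeOfQuasiIso`
  (`exact_baseChange_of_quasiIso_of_exact_residueField`, `function_exact_baseChange_iff_of_quasiIso`, `function_exact_baseChange_iff_of_linearEquiv`),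
  ★ `StrictlyPerfectVanishingBaseChange` (`exact_baseChange_of_exact_residueField_of_isStrictlyLE`), ★ `QuasiIsoLocal`
  (`isLocalizedModule_map_mk_eq_lTensor`), ★ `FlatQuasiIsoBaseChange` (`exactAt_iff_function_exact`).
-/

set_option autoImplicit false

universe u

open CategoryTheory CategoryTheory.Limits AlgebraicGeometry TensorProduct Module
open Literature.Algebra.Homology

noncomputable section

namespace Literature.AlgebraicGeometry.Modules

open Literature.AlgebraicGeometry.Morphisms Literature.AlgebraicGeometry.HodgeTheory Literature.AlgebraicGeometry.Motives

/-! ### §2 Ladders: `Function.Exact` of base-changed pairs along `cancelBaseChange`, `assoc`, `lid` -/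

section Ladders

variable {R : Type u} [CommRing R] {M N W : Type u} [AddCommGroup M] [Module R M] [AddCommGroup N] [Module R N]
  [AddCommGroup W] [Module R W] (d : M →ₗ[R] N) (d' : N →ₗ[R] W)

/-- **`((d ⊗ A) ⊗_A T)` is exact iff `(d ⊗ T)` is**, for an `R`-algebra `A` and an `A`-algebra `T` with `IsScalarTower R A T`
(Mathlib `cancelBaseChange : T ⊗_A (A ⊗_R M) ≃ T ⊗_R M`, natural in `M`). [cite: MumfordAV1970, §5 Lemma 2 (p. 49)] -/
theorem function_exact_baseChange_baseChange_iff {A T : Type u} [CommRing A] [Algebra R A] [CommRing T] [Algebra R T]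
    [Algebra A T] [IsScalarTower R A T] :
    Function.Exact ((d.baseChange A).baseChange T) ((d'.baseChange A).baseChange T) ↔
      Function.Exact (d.baseChange T) (d'.baseChange T) := by
  refine (Function.Exact.iff_of_ladder_linearEquiv
    (e₁ := TensorProduct.AlgebraTensorModule.cancelBaseChange R A T T M)
    (e₂ := TensorProduct.AlgebraTensorModule.cancelBaseChange R A T T N)
    (e₃ := TensorProduct.AlgebraTensorModule.cancelBaseChange R A T T W)
    (f₁₂ := (d.baseChange A).baseChange T) (f₂₃ := (d'.baseChange A).baseChange T)
    (g₁₂ := d.baseChange T) (g₂₃ := d'.baseChange T) ?_ ?_).symm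
  · ext t
    simp [LinearMap.baseChange_tmul]
  · ext t
    simp [LinearMap.baseChange_tmul]

/-- **`((d ⊗ B) ⊗_R A)` is exact iff `(d ⊗ (A ⊗_R B))` is** (Mathlib `TensorProduct.assoc`, natural in `M`).
[cite: AtiyahMacdonald1969, Ch. 3 Prop. 3.5] -/
theorem function_exact_baseChange_baseChange_iff_tensor {A B : Type u} [CommRing A] [Algebra R A] [CommRing B] [Algebra R B] :
    Function.Exact (((d.baseChange B).restrictScalars R).baseChange A) (((d'.baseChange B).restrictScalars R).baseChange A) ↔
      Function.Exact (d.baseChange (A ⊗[R] B)) (d'.baseChange (A ⊗[R] B)) := by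
  refine (Function.Exact.iff_of_ladder_linearEquiv
    (e₁ := (TensorProduct.assoc R A B M).restrictScalars R)
    (e₂ := (TensorProduct.assoc R A B N).restrictScalars R)
    (e₃ := (TensorProduct.assoc R A B W).restrictScalars R)
    (f₁₂ := (d.baseChange (A ⊗[R] B)).restrictScalars R) (f₂₃ := (d'.baseChange (A ⊗[R] B)).restrictScalars R)
    (g₁₂ := (((d.baseChange B).restrictScalars R).baseChange A).restrictScalars R)
    (g₂₃ := (((d'.baseChange B).restrictScalars R).baseChange A).restrictScalars R) ?_ ?_)
  · ext a b m
    simp [LinearMap.baseChange_tmul]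
  · ext a b n
    simp [LinearMap.baseChange_tmul]

/-- **`(d ⊗ R)` is exact iff `d` is** (Mathlib `TensorProduct.lid`, natural in `M`). [cite: AtiyahMacdonald1969, Ch. 3 Prop. 3.5] -/
theorem function_exact_baseChange_self_iff :
    Function.Exact (d.baseChange R) (d'.baseChange R) ↔ Function.Exact d d' := by
  refine (Function.Exact.iff_of_ladder_linearEquiv
    (e₁ := TensorProduct.lid R M) (e₂ := TensorProduct.lid R N) (e₃ := TensorProduct.lid R W)
    (f₁₂ := (d.baseChange R).restrictScalars R) (f₂₃ := (d'.baseChange R).restrictScalars R)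
    (g₁₂ := d) (g₂₃ := d') ?_ ?_).symm
  · ext m
    simp [LinearMap.baseChange_tmul]
  · ext n
    simp [LinearMap.baseChange_tmul]

end Ladders

/-! ### §3 Cohomology and base change above the vanishing line, globalised over the maximal ideals -/

section Global

variable {R : Type u} [CommRing R]

/-- **THE ★ LOCAL THEOREM OVER A LOCAL `R`-ALGEBRA `R'`, read on `R`-linear data**: `P•` strictly perfect over `R` (finite projective
terms, zero above `r`); if `P• ⊗_R κ(R')` is exact in every degree `i ≥ q`, then `P• ⊗_R T` is exact in every degree `i ≥ q` for every
`R'`-algebra `T` in the tower `R → R' → T` (★ `exact_baseChange_of_exact_residueField_of_isStrictlyLE` on `R' ⊗_R P•`, §2 ladders).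
[cite: MumfordAV1970, §5 Cor. 3 (p. 53)] [cite: Hartshorne1977, III Thm. 12.11 (p. 290)] -/
theorem exact_baseChange_of_exact_residueField_algebra (R' : Type u) [CommRing R'] [IsLocalRing R'] [Algebra R R']
    (P : CochainComplex (ModuleCat.{u} R) ℤ) (r : ℤ) [P.IsStrictlyLE r]
    (hP : ∀ n, Module.Finite R (P.X n) ∧ Module.Projective R (P.X n)) (q : ℤ)
    (hfib : ∀ i, q ≤ i → Function.Exact ((P.d (i - 1) i).hom.baseChange (IsLocalRing.ResidueField R'))
      ((P.d i (i + 1)).hom.baseChange (IsLocalRing.ResidueField R')))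
    (T : Type u) [CommRing T] [Algebra R T] [Algebra R' T] [IsScalarTower R R' T] (i : ℤ) (hi : q ≤ i) :
    Function.Exact ((P.d (i - 1) i).hom.baseChange T) ((P.d i (i + 1)).hom.baseChange T) := by
  haveI := isStrictlyLE_baseChangeComplex R' P r
  have hfib' : ∀ j, q ≤ j →
      Function.Exact (((baseChangeComplex R' P).d (j - 1) j).hom.baseChange (IsLocalRing.ResidueField R'))
        (((baseChangeComplex R' P).d j (j + 1)).hom.baseChange (IsLocalRing.ResidueField R')) := fun j hj =>
    (function_exact_baseChange_baseChange_iff (T := IsLocalRing.ResidueField R') (P.d (j - 1) j).hom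
      (P.d j (j + 1)).hom).2 (hfib j hj)
  have hloc := (exact_baseChange_of_exact_residueField_of_isStrictlyLE (baseChangeComplex R' P) r
    (finite_projective_baseChangeComplex_X R' P hP) q hfib').1 T i hi
  exact (function_exact_baseChange_baseChange_iff (T := T) (P.d (i - 1) i).hom (P.d i (i + 1)).hom).1 hloc

/-- **COHOMOLOGY AND BASE CHANGE ABOVE THE VANISHING LINE OVER ANY BASE RING** (strictly perfect form): `P•` a complex of finite
projective `R`-modules, zero above `r`; if `P• ⊗_R κ(𝔪)` is exact in every degree `i ≥ q` for EVERY MAXIMAL IDEAL `𝔪` of `R`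
(`κ(𝔪)` = Mathlib `Ideal.ResidueField`), then `P• ⊗_R B` is exact in every degree `i ≥ q` for EVERY `R`-algebra `B`.  Proof:
exactness of the pair `(d ⊗ B)` is local on `Spec R` (Mathlib `exact_of_isLocalized_maximal`, localisation = `R_𝔪 ⊗_R –` ★
`isLocalizedModule_map_mk_eq_lTensor`); `R_𝔪 ⊗_R (B ⊗_R P•) ≅ (R_𝔪 ⊗_R B) ⊗ P•` (§2) and the previous theorem over `R' := R_𝔪` with
`T := R_𝔪 ⊗_R B`. [cite: MumfordAV1970, §5 Cor. 3 (p. 53)] [cite: AtiyahMacdonald1969, Ch. 3 Props. 3.8–3.9] [cite: EGAIII2, 7.7.5] -/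
theorem exact_baseChange_of_forall_isMaximal_exact_residueField (P : CochainComplex (ModuleCat.{u} R) ℤ) (r : ℤ)
    [P.IsStrictlyLE r] (hP : ∀ n, Module.Finite R (P.X n) ∧ Module.Projective R (P.X n)) (q : ℤ)
    (hfib : ∀ (m : Ideal R) [m.IsMaximal], ∀ i, q ≤ i →
      Function.Exact ((P.d (i - 1) i).hom.baseChange m.ResidueField) ((P.d i (i + 1)).hom.baseChange m.ResidueField))
    (B : Type u) [CommRing B] [Algebra R B] (i : ℤ) (hi : q ≤ i) :
    Function.Exact ((P.d (i - 1) i).hom.baseChange B) ((P.d i (i + 1)).hom.baseChange B) := by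
  have key : Function.Exact (((P.d (i - 1) i).hom.baseChange B).restrictScalars R)
      (((P.d i (i + 1)).hom.baseChange B).restrictScalars R) := by
    refine exact_of_isLocalized_maximal
      (fun m _ => Localization.AtPrime m ⊗[R] (B ⊗[R] P.X (i - 1)))
      (fun m _ => TensorProduct.mk R (Localization.AtPrime m) (B ⊗[R] P.X (i - 1)) 1)
      (fun m _ => Localization.AtPrime m ⊗[R] (B ⊗[R] P.X i))
      (fun m _ => TensorProduct.mk R (Localization.AtPrime m) (B ⊗[R] P.X i) 1)
      (fun m _ => Localization.AtPrime m ⊗[R] (B ⊗[R] P.X (i + 1)))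
      (fun m _ => TensorProduct.mk R (Localization.AtPrime m) (B ⊗[R] P.X (i + 1)) 1)
      _ _ fun m _ => ?_
    rw [isLocalizedModule_map_mk_eq_lTensor, isLocalizedModule_map_mk_eq_lTensor, ← LinearMap.baseChange_eq_ltensor,
      ← LinearMap.baseChange_eq_ltensor, function_exact_baseChange_baseChange_iff_tensor]
    exact exact_baseChange_of_exact_residueField_algebra (Localization.AtPrime m) P r hP q (hfib m)
      (Localization.AtPrime m ⊗[R] B) i hi
  exact key

variable {P C : CochainComplex (ModuleCat.{u} R) ℤ} (ψ : P ⟶ C)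

/-- **THE SAME ON THE FLAT COMPLEX `C•` THROUGH A STRICTLY PERFECT WITNESS `ψ : P• ⥲ C•`** (Mumford §5 Lemma 2 ★
`function_exact_baseChange_iff_of_quasiIso` moves both the hypothesis and the conclusion across `ψ`): `C•` termwise flat, both zero
above `r`; `C• ⊗ κ(𝔪)` exact in degrees `≥ q` for every maximal `𝔪` ⇒ `C• ⊗ B` exact in degrees `≥ q` for every `R`-algebra `B`.
[cite: MumfordAV1970, §5 Lemma 2 (p. 49) and Cor. 3 (p. 53)] [cite: Hartshorne1977, III Thm. 12.11 (p. 290)] -/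
theorem exact_baseChange_of_quasiIso_of_forall_isMaximal_exact_residueField [QuasiIso ψ] (r : ℤ) [P.IsStrictlyLE r]
    [C.IsStrictlyLE r] (hP : ∀ n, Module.Finite R (P.X n) ∧ Module.Projective R (P.X n))
    (hC : ∀ n, Module.Flat R (C.X n)) (q : ℤ)
    (hfib : ∀ (m : Ideal R) [m.IsMaximal], ∀ i, q ≤ i →
      Function.Exact ((C.d (i - 1) i).hom.baseChange m.ResidueField) ((C.d i (i + 1)).hom.baseChange m.ResidueField))
    (B : Type u) [CommRing B] [Algebra R B] (i : ℤ) (hi : q ≤ i) :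
    Function.Exact ((C.d (i - 1) i).hom.baseChange B) ((C.d i (i + 1)).hom.baseChange B) := by
  have hPf := flat_X_of_finite_projective hP
  have hfibP : ∀ (m : Ideal R) [m.IsMaximal], ∀ j, q ≤ j →
      Function.Exact ((P.d (j - 1) j).hom.baseChange m.ResidueField) ((P.d j (j + 1)).hom.baseChange m.ResidueField) :=
    fun m _ j hj => (function_exact_baseChange_iff_of_quasiIso ψ hPf hC r _ j).2 (hfib m j hj)
  exact (function_exact_baseChange_iff_of_quasiIso ψ hPf hC r B i).1
    (exact_baseChange_of_forall_isMaximal_exact_residueField P r hP q hfibP B i hi)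

/-- Corollary `B := R`: **`C•` ITSELF is exact in every degree `i ≥ q`** (`Function.Exact` of the differentials).
[cite: MumfordAV1970, §5 Cor. 3 (p. 53)] -/
theorem function_exact_of_quasiIso_of_forall_isMaximal_exact_residueField [QuasiIso ψ] (r : ℤ) [P.IsStrictlyLE r]
    [C.IsStrictlyLE r] (hP : ∀ n, Module.Finite R (P.X n) ∧ Module.Projective R (P.X n))
    (hC : ∀ n, Module.Flat R (C.X n)) (q : ℤ)
    (hfib : ∀ (m : Ideal R) [m.IsMaximal], ∀ i, q ≤ i →
      Function.Exact ((C.d (i - 1) i).hom.baseChange m.ResidueField) ((C.d i (i + 1)).hom.baseChange m.ResidueField))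
    (i : ℤ) (hi : q ≤ i) :
    Function.Exact (C.d (i - 1) i).hom (C.d i (i + 1)).hom :=
  (function_exact_baseChange_self_iff _ _).1
    (exact_baseChange_of_quasiIso_of_forall_isMaximal_exact_residueField ψ r hP hC q hfib R i hi)

/-- The same in Mathlib's `ExactAt` currency: `C•.ExactAt i` for `i ≥ q`. [cite: MumfordAV1970, §5 Cor. 3 (p. 53)] -/
theorem exactAt_of_quasiIso_of_forall_isMaximal_exact_residueField [QuasiIso ψ] (r : ℤ) [P.IsStrictlyLE r]
    [C.IsStrictlyLE r] (hP : ∀ n, Module.Finite R (P.X n) ∧ Module.Projective R (P.X n))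
    (hC : ∀ n, Module.Flat R (C.X n)) (q : ℤ)
    (hfib : ∀ (m : Ideal R) [m.IsMaximal], ∀ i, q ≤ i →
      Function.Exact ((C.d (i - 1) i).hom.baseChange m.ResidueField) ((C.d i (i + 1)).hom.baseChange m.ResidueField))
    (i : ℤ) (hi : q ≤ i) : C.ExactAt i := by
  rw [exactAt_iff_function_exact C (i - 1) i (i + 1) (by omega) rfl]
  exact function_exact_of_quasiIso_of_forall_isMaximal_exact_residueField ψ r hP hC q hfib i hi

end Global

/-! ### §4 The Čech form: a proper flat family over an affine noetherian base, a vector bundle, a finite affine cover -/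

section Cech

variable {X B : Scheme.{0}} (g : X ⟶ B) [IsAffine B] [IsProper g] [IsLocallyNoetherian B] [Flat g]
  {ι : Type} [LinearOrder ι] [Fintype ι] (U : ι → X.Opens) (hcov : ⨆ i, U i = ⊤)
  (hUa : ∀ s : Finset ι, s.Nonempty → IsAffineOpen (cechOpen U s)) (G : X.Modules) (hL : IsFiniteLocallyFree G)

include hcov hUa hL in
/-- **(CBC-1) FIBREWISE-EXACT AT EVERY MAXIMAL IDEAL ⇒ EXACT AFTER EVERY BASE CHANGE** for the module Čech complex `C• = Č•(𝓤, G)` of a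
finite locally free `G` on a proper flat `g : X → B`, `B` affine locally noetherian, `𝓤` a finite cover with affine finite intersections:
if `C• ⊗_{Γ(B)} κ(𝔪)` is exact in every degree `i ≥ q` for every maximal ideal `𝔪 ⊂ Γ(B, 𝒪_B)`, then `C• ⊗_{Γ(B)} B'` is exact in every
degree `i ≥ q` for every `Γ(B, 𝒪_B)`-algebra `B'` (★ Grothendieck complex `exists_strictlyPerfect_quasiIso_cechComplex_of_isProper`, ★
`flat_cechComplex_X`, §3). [cite: MumfordAV1970, §5 Lemma 1 (p. 47), Cor. 3 (p. 53)] [cite: GortzWedhorn2023, Cor. 23.135 (p. 355); Thm. 23.140]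
[cite: Hartshorne1977, III Thm. 12.11 (p. 290)] -/
theorem cechComplex_exact_baseChange_of_forall_isMaximal (q : ℤ)
    (hfib : ∀ (m : Ideal Γ(B, ⊤)) [m.IsMaximal], ∀ i, q ≤ i →
      Function.Exact (((cechComplex U G g.appTop.hom).d (i - 1) i).hom.baseChange m.ResidueField)
        (((cechComplex U G g.appTop.hom).d i (i + 1)).hom.baseChange m.ResidueField))
    (B' : Type) [CommRing B'] [Algebra Γ(B, ⊤) B'] (i : ℤ) (hi : q ≤ i) :
    Function.Exact (((cechComplex U G g.appTop.hom).d (i - 1) i).hom.baseChange B')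
      (((cechComplex U G g.appTop.hom).d i (i + 1)).hom.baseChange B') := by
  obtain ⟨K, ψ, hψ, -, hKle, hK⟩ := exists_strictlyPerfect_quasiIso_cechComplex_of_isProper g U hcov hUa G hL
    (Fintype.card ι) (by omega)
  haveI := hψ
  haveI := hKle
  haveI : (cechComplex U G g.appTop.hom).IsStrictlyLE ((Fintype.card ι : ℕ) : ℤ) := isStrictlyLE_cechComplex U G _ _ (by omega)
  have hflat := flat_cechComplex_X U G _ (flat_secMod_of_flat g U hUa G hL)
  exact exact_baseChange_of_quasiIso_of_forall_isMaximal_exact_residueField ψ ((Fintype.card ι : ℕ) : ℤ) hK hflat q hfib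
    B' i hi

include hcov hUa hL in
/-- **(CBC-1) corollary: `Hⁱ(Č•(𝓤, G)) = 0` for `i ≥ q`** when every fibre at a maximal ideal is acyclic in degrees `≥ q` — the global
sections of the statement «fibrewise-acyclic ⇒ acyclic» of Step 1 of [MumfordAV1970] §8 Thm. 1. [cite: MumfordAV1970, §5 Cor. 3 (p. 53); §8 Thm. 1 (p. 77)]
[cite: GortzWedhorn2023, Thm. 23.140] -/
theorem cechComplex_exactAt_of_forall_isMaximal (q : ℤ)
    (hfib : ∀ (m : Ideal Γ(B, ⊤)) [m.IsMaximal], ∀ i, q ≤ i →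
      Function.Exact (((cechComplex U G g.appTop.hom).d (i - 1) i).hom.baseChange m.ResidueField)
        (((cechComplex U G g.appTop.hom).d i (i + 1)).hom.baseChange m.ResidueField))
    (i : ℤ) (hi : q ≤ i) : (cechComplex U G g.appTop.hom).ExactAt i := by
  obtain ⟨K, ψ, hψ, -, hKle, hK⟩ := exists_strictlyPerfect_quasiIso_cechComplex_of_isProper g U hcov hUa G hL
    (Fintype.card ι) (by omega)
  haveI := hψ
  haveI := hKle
  haveI : (cechComplex U G g.appTop.hom).IsStrictlyLE ((Fintype.card ι : ℕ) : ℤ) := isStrictlyLE_cechComplex U G _ _ (by omega)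
  have hflat := flat_cechComplex_X U G _ (flat_secMod_of_flat g U hUa G hL)
  exact exactAt_of_quasiIso_of_forall_isMaximal_exact_residueField ψ ((Fintype.card ι : ℕ) : ℤ) hK hflat q hfib i hi

end Cech

end Literature.AlgebraicGeometry.Modules

end
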